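import Summits.QuantumFields.YangMills.Theses.ThermodynamicCeilings
import Summits.QuantumFields.YangMills.Theorems.ThermodynamicCeilingsAbelAnchoredTransfer
import Summits.QuantumFields.YangMills.Theorems.SquareRootCeilingsMirrorDomination
import Summits.QuantumFields.YangMills.Theorems.SquareRootCeilingsDominationTransfer
import Summits.QuantumFields.YangMills.Theorems.AntiScreeningCeilingsMonotoneTransfer
import HarnessLib

/-!
# Route `ThermodynamicCeilings` (LINE G, ym-idea-11 g6) — the support `TopBandTransferA` (stmt-QuantumFields-28159)

`AnchoredSpectralMeasure → TopBandCeilingC → SqrtDominationC →` the LARGE-VOLUME factorial ceilings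
`|E_T ∏ᵢ(Pᵢ − E_T Pᵢ)| ≤ (C n^κ / R⁴)ⁿ` on the odd tori `(ℤ/(2L+1))⁴` with `L ≥ L₀(β)`.

Proof (bookkeeping and real arithmetic over route statements, plus three landed tools):
* ANCHOR (β-uniform): at `β ≥ β₄` the floor carriers form a non-empty set `F ⊆ (0,1]`; any carrier `σ(β) > sup F / 2` is itself
  sub-onset and near-onset, and `σ < 2s` for EVERY sub-onset `s` — so `σ`, `R₂ := ⌊ℓ/σ⌋` and the volume threshold
  `L₀(β) := 4R₂ + 8` are chosen BEFORE `s` (`anchor_uniform`).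
* TOP BAND: with `ℓ₄ := ℓ/2`, every admissible `R` (`Rs ≤ ℓ₄`) has `R ≤ R₂`, `R₂σ ≤ ℓ < 2R₂σ` (`topBand_sep`), and `4R₂+8 ≤ L` is the
  large-volume hypothesis; `TopBandCeilingC` bounds the on-axis mirror covariance by `(C/R₂⁴)²` on `[2R₂+2, L]`.
* ABEL: `AnchoredSpectralMeasure` at resolution `σ` + the landed one-anchor Abel transfer
  `ScaleMonotonicity.SpectralA.abelAnchoredTransfer_core` (anchor `x₀ = max(σ/ℓ, 4/L)`, `1 ≤ x₀(t₂−1)`, `x₀t₂ ≤ 4`, shift `t ↦ t−δ`,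
  `T = 2L+1−2δ`, constant `A″ = (e⁴(1+2A·16⁸) + A²8⁸e⁶ + 1)·(4/3)⁸`) carries the bound from `t₂ = 2R₂+2` down to `t ∈ [2R+2, t₂)`
  (`abel_step` + the landed `AntiScreeningCeilings.transfer_bound`): axis mirror ceiling `(16A″C/R⁴)²` on `[2R+2, L]`.
* MIRROR DOMINATION per torus (landed `MirrorDomination.abs_cov_le_of_axisMirror`, reflection-positivity Cauchy–Schwarz) and
  `SqrtDominationC` per torus with the envelope `b := (16A″C/R⁴)²` (as in the landed `dominationTransfer_proof`).
Constants: `C_final := C₂·16A″C`, `κ := θ`, `ℓ₄ := min(ℓ_M, ℓ_T)/2`, `β₄ := max(β_M, β_T, β_D, β₅, 0)`.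
Only this implication between route items is proved; no summit / leaf / NT / UV / IR / mass-gap statement is proved here.
-/

set_option autoImplicit false

noncomputable section

namespace Summit.QuantumFields.YangMills.Theorems.TopBandTransferA

open MeasureTheory Set
open Literature.MathematicalPhysics.QuantumFieldTheory Literature.MathematicalPhysics.QuantumLattice
open Summit.QuantumFields.YangMills.Cruxes.OSLegsFromFemtoAndGap.DlrCollarTransfer
open Summit.QuantumFields.YangMills.Theses.ThermodynamicCeilings
open Summit.QuantumFields.YangMills.Theses.AntiScreeningCeilings (transfer_bound weaken_bound)
open Summit.QuantumFields.YangMills.Cruxes.ScaleMonotonicity.SpectralA (abelAnchoredTransfer_core)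
open Summit.QuantumFields.YangMills.Theorems.MirrorDomination (abs_cov_le_of_axisMirror)

/-! ## §1 The β-uniform anchor and the top-band separation -/

/-- **β-UNIFORM ANCHOR.** If some `sf ∈ (0,1]` carries the floor predicate `P`, there is a carrier `σ ∈ (0,1]` which is itself
sub-onset (no `P` on `[2σ,1]`) and lies strictly below `2s` for EVERY sub-onset `s` — `σ` is any carrier above half the
supremum of the carriers, chosen independently of `s`. [cite: OsterwalderSeiler1978, §2 (bookkeeping)] -/
theorem anchor_uniform (P : ℝ → Prop) {sf : ℝ} (hsf0 : 0 < sf) (hsf1 : sf ≤ 1) (hPf : P sf) :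
    ∃ σ : ℝ, 0 < σ ∧ σ ≤ 1 ∧ P σ ∧ (∀ s' : ℝ, 2 * σ ≤ s' → s' ≤ 1 → ¬ P s') ∧
      ∀ s : ℝ, (∀ s' : ℝ, 2 * s ≤ s' → s' ≤ 1 → ¬ P s') → σ < 2 * s := by
  set F : Set ℝ := {x : ℝ | 0 < x ∧ x ≤ 1 ∧ P x} with hF
  have hne : F.Nonempty := ⟨sf, hsf0, hsf1, hPf⟩
  have hbdd : BddAbove F := ⟨1, fun x hx => hx.2.1⟩
  have hMpos : 0 < sSup F := lt_of_lt_of_le hsf0 (le_csSup hbdd ⟨hsf0, hsf1, hPf⟩)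
  have hlt : sSup F / 2 < sSup F := by linarith
  obtain ⟨σ, hσF, hσ⟩ := exists_lt_of_lt_csSup hne hlt
  obtain ⟨hσ0, hσ1, hPσ⟩ := hσF
  refine ⟨σ, hσ0, hσ1, hPσ, ?_, ?_⟩
  · intro s' h2 h1 hP'
    have hs'0 : 0 < s' := by linarith
    have : s' ≤ sSup F := le_csSup hbdd ⟨hs'0, h1, hP'⟩
    linarith
  · intro s hsub
    by_contra h
    push Not at h
    exact hsub σ h hσ1 hPσ

/-- **TOP-BAND SEPARATION.** With `σ < 2s`, `1 ≤ R` and `Rs ≤ ℓ/2`: `R₂ := ⌊ℓ/σ⌋` satisfies `R ≤ R₂`, `R₂σ ≤ ℓ`, the top-band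
inequality `ℓ < 2R₂σ`, `1 ≤ R₂`, and `σ ≤ ℓ`. [cite: OsterwalderSeiler1978, §2 (bookkeeping)] -/
theorem topBand_sep {σ ℓ s : ℝ} {R : ℕ} (hσ : 0 < σ) (hσs : σ < 2 * s) (hR : 1 ≤ R) (hRs : (R : ℝ) * s ≤ ℓ / 2) :
    R ≤ ⌊ℓ / σ⌋₊ ∧ (⌊ℓ / σ⌋₊ : ℝ) * σ ≤ ℓ ∧ ℓ < 2 * (⌊ℓ / σ⌋₊ : ℝ) * σ ∧ 1 ≤ ⌊ℓ / σ⌋₊ ∧ σ ≤ ℓ := by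
  have hRpos : (0 : ℝ) < R := by exact_mod_cast (lt_of_lt_of_le Nat.zero_lt_one hR)
  have hR1 : (1 : ℝ) ≤ R := by exact_mod_cast hR
  have hRσ : (R : ℝ) * σ ≤ ℓ := by
    have : (R : ℝ) * σ ≤ (R : ℝ) * (2 * s) := mul_le_mul_of_nonneg_left hσs.le hRpos.le
    nlinarith
  have hℓσ : (R : ℝ) ≤ ℓ / σ := by rw [le_div_iff₀ hσ]; exact hRσ
  have hRR₂ : R ≤ ⌊ℓ / σ⌋₊ := Nat.le_floor hℓσ
  have hℓσ0 : 0 ≤ ℓ / σ := le_trans hRpos.le hℓσ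
  have hfl : (⌊ℓ / σ⌋₊ : ℝ) ≤ ℓ / σ := Nat.floor_le hℓσ0
  have hR₂1 : 1 ≤ ⌊ℓ / σ⌋₊ := hR.trans hRR₂
  have hR₂1R : (1 : ℝ) ≤ (⌊ℓ / σ⌋₊ : ℝ) := by exact_mod_cast hR₂1
  refine ⟨hRR₂, by rwa [le_div_iff₀ hσ] at hfl, ?_, hR₂1, ?_⟩
  · have hlt : ℓ / σ < (⌊ℓ / σ⌋₊ : ℝ) + 1 := Nat.lt_floor_add_one _
    rw [div_lt_iff₀ hσ] at hlt
    nlinarith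
  · have : σ ≤ (R : ℝ) * σ := le_mul_of_one_le_left hσ.le hR1
    linarith

/-! ## §2 The Abel step on one torus (anchored transfer in the route's currency) -/

/-- **ABEL STEP.** For a separation function `c` with the reflection-positivity spectral representation of
`AnchoredSpectralMeasure` (finite measure `ν` on `(0,∞)`, `κ₀ ≥ 0`, shift `δ ≤ 1`, odd torus `2L+1`), the one-anchor degree-8
majorant on `[x₀,1]` and the Laplace UV clause, the landed `abelAnchoredTransfer_core` gives
`t⁸|c(t)| ≤ A″ t₂⁸ |c(t₂)|` for `4 ≤ t ≤ t₂`, `2t₂ ≤ 2L+1`, `1 ≤ x₀(t₂−1)`, `x₀t₂ ≤ 4`, with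
`A″ = (e⁴(1+2A·16⁸) + A²8⁸e⁶ + 1)·(4/3)⁸`. [cite: GlimmJaffe1987, §6.2 (reflection positivity, transfer matrix); OsterwalderSeiler1978, §2] -/
theorem abel_step (c : ℕ → ℝ) (ν : Measure ℝ) (κ₀ A x₀ : ℝ) (δ L : ℕ) (hfin : IsFiniteMeasure ν)
    (hsupp : ν (Iic 0) = 0) (hκ₀ : 0 ≤ κ₀) (hA : 1 ≤ A) (hx₀ : 0 < x₀) (hx₀1 : x₀ ≤ 1) (hδ : δ ≤ 1)
    (hrep : ∀ t : ℕ, 2 ≤ t → t + 2 ≤ 2 * L + 1 →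
      c t = κ₀ + ∫ E, (Real.exp (-(E * ((t : ℝ) - δ))) + Real.exp (-(E * (((2 * L + 1 : ℕ) : ℝ) - δ - (t : ℝ))))) ∂ν)
    (hmaj : ∀ E : ℝ, x₀ ≤ E → E ≤ 1 → (ν (Iio E)).toReal ≤ A * (E / x₀) ^ 8 * (ν (Iio x₀)).toReal)
    (huv : (∫ E in Ici (1 : ℝ), Real.exp (-(2 * E)) ∂ν) ≤ A * (ν (Iio 1)).toReal)
    {t t₂ : ℕ} (ht : 4 ≤ t) (htt : t ≤ t₂) (ht₂L : 2 * t₂ ≤ 2 * L + 1) (h1 : 1 ≤ x₀ * ((t₂ : ℝ) - 1))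
    (h4 : x₀ * (t₂ : ℝ) ≤ 4) :
    (t : ℝ) ^ 8 * |c t| ≤
      ((Real.exp 4 * (1 + 2 * A * 16 ^ 8) + A ^ 2 * 8 ^ 8 * Real.exp 6 + 1) * (4 / 3 : ℝ) ^ 8) *
        ((t₂ : ℝ)) ^ 8 * |c t₂| := by
  set A' : ℝ := Real.exp 4 * (1 + 2 * A * 16 ^ 8) + A ^ 2 * 8 ^ 8 * Real.exp 6 + 1 with hA'
  have hA'0 : 0 ≤ A' := by rw [hA']; positivity
  have ht4R : (4 : ℝ) ≤ (t : ℝ) := by exact_mod_cast ht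
  have httR : (t : ℝ) ≤ (t₂ : ℝ) := by exact_mod_cast htt
  have hδR : (δ : ℝ) ≤ 1 := by exact_mod_cast hδ
  have hδ0 : (0 : ℝ) ≤ (δ : ℝ) := Nat.cast_nonneg δ
  have ht₂L' : 2 * (t₂ : ℝ) ≤ ((2 * L + 1 : ℕ) : ℝ) := by exact_mod_cast ht₂L
  have hT2 : 2 * ((t₂ : ℝ) - δ) ≤ (((2 * L + 1 : ℕ) : ℝ) - 2 * δ) := by linarith
  have h1' : 1 ≤ x₀ * ((t₂ : ℝ) - δ) := by
    have : x₀ * ((t₂ : ℝ) - 1) ≤ x₀ * ((t₂ : ℝ) - δ) := mul_le_mul_of_nonneg_left (by linarith) hx₀.le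
    linarith
  have h4' : x₀ * ((t₂ : ℝ) - δ) ≤ 4 := by
    have : x₀ * ((t₂ : ℝ) - δ) ≤ x₀ * (t₂ : ℝ) := mul_le_mul_of_nonneg_left (by linarith) hx₀.le
    linarith
  have key := abelAnchoredTransfer_core ν κ₀ A x₀ (((2 * L + 1 : ℕ) : ℝ) - 2 * δ) hfin hsupp hκ₀ hA hx₀ hx₀1 hmaj huv
    ((t : ℝ) - δ) ((t₂ : ℝ) - δ) (by linarith) (by linarith) hT2 h1' h4'
  rw [show (((2 * L + 1 : ℕ) : ℝ) - 2 * δ - ((t : ℝ) - δ)) = (((2 * L + 1 : ℕ) : ℝ) - δ - (t : ℝ)) by ring,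
    show (((2 * L + 1 : ℕ) : ℝ) - 2 * δ - ((t₂ : ℝ) - δ)) = (((2 * L + 1 : ℕ) : ℝ) - δ - (t₂ : ℝ)) by ring] at key
  have hrt := hrep t (by omega) (by omega)
  have hrt₂ := hrep t₂ (by omega) (by omega)
  have nonneg : ∀ τ : ℕ, 0 ≤ κ₀ + ∫ E, (Real.exp (-(E * ((τ : ℝ) - δ))) +
      Real.exp (-(E * (((2 * L + 1 : ℕ) : ℝ) - δ - (τ : ℝ))))) ∂ν :=
    fun τ => add_nonneg hκ₀ (integral_nonneg fun E => by positivity)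
  rw [hrt, hrt₂, abs_of_nonneg (nonneg t), abs_of_nonneg (nonneg t₂)]
  have hpow1 : (t : ℝ) ^ 8 ≤ (4 / 3 : ℝ) ^ 8 * ((t : ℝ) - δ) ^ 8 := by
    rw [← mul_pow]
    exact pow_le_pow_left₀ (by positivity) (by linarith) 8
  have hpow2 : ((t₂ : ℝ) - δ) ^ 8 ≤ (t₂ : ℝ) ^ 8 :=
    pow_le_pow_left₀ (by linarith) (by linarith) 8
  calc (t : ℝ) ^ 8 * (κ₀ + ∫ E, (Real.exp (-(E * ((t : ℝ) - δ))) + Real.exp (-(E * (((2 * L + 1 : ℕ) : ℝ) - δ - (t : ℝ))))) ∂ν)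
      ≤ (4 / 3 : ℝ) ^ 8 * ((t : ℝ) - δ) ^ 8 * (κ₀ + ∫ E, (Real.exp (-(E * ((t : ℝ) - δ))) +
          Real.exp (-(E * (((2 * L + 1 : ℕ) : ℝ) - δ - (t : ℝ))))) ∂ν) :=
        mul_le_mul_of_nonneg_right hpow1 (nonneg t)
    _ = (4 / 3 : ℝ) ^ 8 * (((t : ℝ) - δ) ^ 8 * (κ₀ + ∫ E, (Real.exp (-(E * ((t : ℝ) - δ))) +
          Real.exp (-(E * (((2 * L + 1 : ℕ) : ℝ) - δ - (t : ℝ))))) ∂ν)) := by ring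
    _ ≤ (4 / 3 : ℝ) ^ 8 * (A' * ((t₂ : ℝ) - δ) ^ 8 * (κ₀ + ∫ E, (Real.exp (-(E * ((t₂ : ℝ) - δ))) +
          Real.exp (-(E * (((2 * L + 1 : ℕ) : ℝ) - δ - (t₂ : ℝ))))) ∂ν)) :=
        mul_le_mul_of_nonneg_left key (by positivity)
    _ ≤ (4 / 3 : ℝ) ^ 8 * (A' * (t₂ : ℝ) ^ 8 * (κ₀ + ∫ E, (Real.exp (-(E * ((t₂ : ℝ) - δ))) +
          Real.exp (-(E * (((2 * L + 1 : ℕ) : ℝ) - δ - (t₂ : ℝ))))) ∂ν)) := by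
        rw [mul_assoc (A'), mul_assoc (A')]
        exact mul_le_mul_of_nonneg_left
          (mul_le_mul_of_nonneg_left (mul_le_mul_of_nonneg_right hpow2 (nonneg t₂)) hA'0) (by positivity)
    _ = A' * (4 / 3 : ℝ) ^ 8 * (t₂ : ℝ) ^ 8 * (κ₀ + ∫ E, (Real.exp (-(E * ((t₂ : ℝ) - δ))) +
          Real.exp (-(E * (((2 * L + 1 : ℕ) : ℝ) - δ - (t₂ : ℝ))))) ∂ν) := by ring

/-! ## §3 The route item -/

set_option maxHeartbeats 400000 in
/-- **`ThermodynamicCeilings.TopBandTransferA` (stmt-QuantumFields-28159) holds**: `AnchoredSpectralMeasure → TopBandCeilingC →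
SqrtDominationC →` the large-volume factorial ceilings `(C n^κ/R⁴)ⁿ` on tori `L ≥ L₀(β) = 4⌊ℓ/σ(β)⌋ + 8`, `σ(β)` a β-uniform
near-onset sub-onset anchor; constants `C := C₂·16·A″·C_T`, `κ := θ`, `ℓ₄ := min(ℓ_M,ℓ_T)/2`, `β₄ := max(β_M,β_T,β_D,β₅,0)`.
Only an implication between route items; the cruxes `AnchoredSpectralMeasure`, `TopBandCeilingC`, `SqrtDominationC` stay open and
no summit / leaf / NT / UV / IR statement is proved. [cite: OsterwalderSeiler1978, §2; GlimmJaffe1987, §6.2; Newman1975Gaussian, Thm. 1 (role of the two-point envelope)] -/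
theorem topBandTransferA_proof : TopBandTransferA := by
  intro hAn hTop hD G _ _ _ _ hG hSU
  letI : MeasurableSpace G := borel G
  haveI : BorelSpace G := ⟨rfl⟩
  intro r v f g h Λ₅
  obtain ⟨εA, hεA, HA⟩ := hAn G hG hSU r v f g h Λ₅
  have hTop' : Summit.QuantumFields.YangMills.Theses.AntiScreeningCeilings.TopBandCeiling := hTop
  have hD' : Summit.QuantumFields.YangMills.Theses.SquareRootCeilings.SqrtDomination := hD
  obtain ⟨εT, hεT, HT⟩ := hTop' G hG hSU r v f g h Λ₅
  obtain ⟨C₂, θ, βD, hC₂, hθ, HD⟩ := hD' G hG hSU r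
  refine ⟨min εA εT, lt_min hεA hεT, fun ε hε hεle hfl => ?_⟩
  obtain ⟨ℓM, hℓM, HA1⟩ := HA ε hε (le_trans hεle (min_le_left _ _)) hfl
  obtain ⟨ℓT, hℓT, HT1⟩ := HT ε hε (le_trans hεle (min_le_right _ _)) hfl
  have hℓpos : 0 < min ℓM ℓT := lt_min hℓM hℓT
  obtain ⟨A, βM, hA, HA2⟩ := HA1 (min ℓM ℓT) hℓpos (min_le_left _ _)
  obtain ⟨C, βT, hC, HT2⟩ := HT1 (min ℓM ℓT) hℓpos (min_le_right _ _)
  obtain ⟨β₅, hβ₅⟩ := hfl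
  -- the transfer constant
  set A'' : ℝ := (Real.exp 4 * (1 + 2 * A * 16 ^ 8) + A ^ 2 * 8 ^ 8 * Real.exp 6 + 1) * (4 / 3 : ℝ) ^ 8 with hA''
  have hA''1 : 1 ≤ A'' := by
    have h1 : (1 : ℝ) ≤ Real.exp 4 * (1 + 2 * A * 16 ^ 8) + A ^ 2 * 8 ^ 8 * Real.exp 6 + 1 := by
      have : 0 ≤ Real.exp 4 * (1 + 2 * A * 16 ^ 8) + A ^ 2 * 8 ^ 8 * Real.exp 6 := by
        have hA0 : 0 ≤ A := le_trans zero_le_one hA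
        positivity
      linarith
    have h2 : (1 : ℝ) ≤ (4 / 3 : ℝ) ^ 8 := by norm_num
    rw [hA'']
    nlinarith
  have hA''0 : 0 ≤ A'' := le_trans zero_le_one hA''1
  refine ⟨C₂ * (16 * A'' * C), θ, min ℓM ℓT / 2, max (max (max βM βT) (max βD β₅)) 0, half_pos hℓpos,
    by positivity, hθ, ?_⟩
  intro β hβ
  have hβM : βM ≤ β := le_trans (le_trans (le_trans (le_max_left _ _) (le_max_left _ _)) (le_max_left _ _)) hβ
  have hβT : βT ≤ β := le_trans (le_trans (le_trans (le_max_right _ _) (le_max_left _ _)) (le_max_left _ _)) hβ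
  have hβD : βD ≤ β := le_trans (le_trans (le_trans (le_max_left _ _) (le_max_right _ _)) (le_max_left _ _)) hβ
  have hβ5 : β₅ ≤ β := le_trans (le_trans (le_trans (le_max_right _ _) (le_max_right _ _)) (le_max_left _ _)) hβ
  have hβ0 : (0 : ℝ) ≤ β := le_trans (le_max_right _ _) hβ
  -- a floor carrier at this β and the β-UNIFORM near-onset sub-onset anchor σ
  obtain ⟨sf, hsf0, hsf1, hPf⟩ := hβ₅ β hβ5
  obtain ⟨σ, hσ0, hσ1, hPσ, hσsub, hσlt⟩ := anchor_uniform
    (fun s' : ℝ => (∀ L : ℕ, Λ₅ ≤ s' * L → ε ≤ Q2 G r β L s' (thetaTest 4 v) v) ∧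
      (∀ L : ℕ, Λ₅ ≤ s' * L → ε ≤ |Q3 G r β L s' f g h|)) hsf0 hsf1 hPf
  -- the volume threshold
  refine ⟨4 * ⌊min ℓM ℓT / σ⌋₊ + 8, ?_⟩
  intro s hs hs1 hsub L n q x R hq hR hRs hRL hL₀ hsep
  set ℓ : ℝ := min ℓM ℓT with hℓ
  set R₂ : ℕ := ⌊ℓ / σ⌋₊ with hR₂
  have hσs : σ < 2 * s := hσlt s hsub
  obtain ⟨hRR₂, hR₂σ, htop, hR₂1, hσℓ⟩ := topBand_sep hσ0 hσs hR hRs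
  have hR₂L : 4 * R₂ + 8 ≤ L := hL₀
  have hRpos : (0 : ℝ) < R := by exact_mod_cast (lt_of_lt_of_le Nat.zero_lt_one hR)
  -- STEP A: the axis mirror ceiling on this torus, every orientation, every axis, every t ∈ [2R+2, L]
  have haxis : ∀ (q₁ : Fin 4 × Fin 4) (k : Fin 4) (t : ℕ), q₁.1 < q₁.2 → 2 * R + 2 ≤ t → t ≤ L →
      |torusE G r β L (fun U => (plane G r q₁ (fun i => if i = k then (t : ℤ) else 0) U -
          torusE G r β L (plane G r q₁ (fun i => if i = k then (t : ℤ) else 0))) *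
        (plane G r q₁ (fun _ => 0) U - torusE G r β L (plane G r q₁ (fun _ => 0))))| ≤
        (16 * A'' * C / (R : ℝ) ^ 4) ^ 2 := by
    intro q₁ k t hq₁ ht htL
    -- the top-band ceiling at the maximal separation R₂, on [2R₂+2, L]
    have hTb : ∀ t' : ℕ, 2 * R₂ + 2 ≤ t' → t' ≤ L →
        |torusE G r β L (fun U => (plane G r q₁ (fun i => if i = k then (t' : ℤ) else 0) U -
            torusE G r β L (plane G r q₁ (fun i => if i = k then (t' : ℤ) else 0))) *
          (plane G r q₁ (fun _ => 0) U - torusE G r β L (plane G r q₁ (fun _ => 0))))| ≤ (C / (R₂ : ℝ) ^ 4) ^ 2 :=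
      fun t' h1 h2 => HT2 β hβT σ hσ0 hσ1 hσsub ⟨σ, by linarith, hσ1, hPσ⟩ L q₁ k R₂ t' hq₁ hR₂1 hR₂σ hR₂L htop h1 h2
    rcases le_or_gt t (2 * R₂ + 2) with hle | hgt
    · -- anchored Abel transfer from t₂ = 2R₂+2 down to t
      obtain ⟨ν, κ₀, δ, hfin, hsupp, hκ₀, hδ, hrep, hmaj, huv⟩ := HA2 β hβM σ hσ0 hσ1 hσsub L q₁ k hq₁
      have hL8 : (8 : ℝ) ≤ (L : ℝ) := by exact_mod_cast (show 8 ≤ L by omega)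
      have hL0 : (0 : ℝ) < (L : ℝ) := by linarith
      have hR₂R : (R₂ : ℝ) ≤ ℓ / σ := by rw [le_div_iff₀ hσ0]; exact hR₂σ
      have hR₂R' : ℓ / σ < (R₂ : ℝ) + 1 := Nat.lt_floor_add_one _
      have hσℓ1 : σ / ℓ ≤ 1 := by rw [div_le_one hℓpos]; exact hσℓ
      have hx₀ : 0 < max (σ / ℓ) (4 / (L : ℝ)) := lt_max_of_lt_left (div_pos hσ0 hℓpos)
      have hx₀1 : max (σ / ℓ) (4 / (L : ℝ)) ≤ 1 := by
        refine max_le hσℓ1 ?_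
        rw [div_le_one hL0]; linarith
      have ht₂R : (((2 * R₂ + 2 : ℕ) : ℝ)) = 2 * (R₂ : ℝ) + 2 := by push_cast; ring
      -- the anchor window: 1 ≤ x₀ (t₂ - 1) and x₀ t₂ ≤ 4
      have h1 : 1 ≤ max (σ / ℓ) (4 / (L : ℝ)) * ((((2 * R₂ + 2 : ℕ) : ℝ)) - 1) := by
        have hlow : 1 ≤ σ / ℓ * ((((2 * R₂ + 2 : ℕ) : ℝ)) - 1) := by
          rw [ht₂R]
          -- (σ/ℓ)(2R₂+1) ≥ 2 - σ/ℓ ≥ 1, from ℓ/σ < R₂ + 1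
          have e1 : σ / ℓ * (2 * (R₂ : ℝ) + 2 - 1) = (2 * (R₂ : ℝ) + 1) * σ / ℓ := by ring
          rw [e1, le_div_iff₀ hℓpos]
          have : ℓ < ((R₂ : ℝ) + 1) * σ := by rwa [div_lt_iff₀ hσ0] at hR₂R'
          nlinarith
        have hmono : σ / ℓ * ((((2 * R₂ + 2 : ℕ) : ℝ)) - 1) ≤
            max (σ / ℓ) (4 / (L : ℝ)) * ((((2 * R₂ + 2 : ℕ) : ℝ)) - 1) :=
          mul_le_mul_of_nonneg_right (le_max_left _ _)
            (by rw [ht₂R]; have : (0 : ℝ) ≤ (R₂ : ℝ) := Nat.cast_nonneg _; linarith)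
        linarith
      have h4 : max (σ / ℓ) (4 / (L : ℝ)) * (((2 * R₂ + 2 : ℕ) : ℝ)) ≤ 4 := by
        rw [ht₂R]
        rcases le_total (σ / ℓ) (4 / (L : ℝ)) with hc | hc
        · rw [max_eq_right hc]
          have hR₂L' : 4 * (R₂ : ℝ) + 8 ≤ (L : ℝ) := by exact_mod_cast hR₂L
          rw [show 4 / (L : ℝ) * (2 * (R₂ : ℝ) + 2) = (8 * (R₂ : ℝ) + 8) / (L : ℝ) by ring, div_le_iff₀ hL0]
          linarith
        · rw [max_eq_left hc]
          rw [show σ / ℓ * (2 * (R₂ : ℝ) + 2) = (2 * ((R₂ : ℝ) * σ) + 2 * σ) / ℓ by ring, div_le_iff₀ hℓpos]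
          linarith
      have hM := abel_step
        (fun t : ℕ => torusE G r β L (fun U => (plane G r q₁ (fun i => if i = k then (t : ℤ) else 0) U -
            torusE G r β L (plane G r q₁ (fun i => if i = k then (t : ℤ) else 0))) *
          (plane G r q₁ (fun _ => 0) U - torusE G r β L (plane G r q₁ (fun _ => 0)))))
        ν κ₀ A (max (σ / ℓ) (4 / (L : ℝ))) δ L hfin hsupp hκ₀ hA hx₀ hx₀1 hδ hrep hmaj (huv hx₀1)
        (t := t) (t₂ := 2 * R₂ + 2) (by omega) hle (by omega) h1 h4
      exact transfer_bound hA''1 hR hRR₂ ht hM (hTb _ le_rfl (by omega))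
    · exact weaken_bound hA''1 hC hR hRR₂ (hTb t hgt.le htL)
  -- STEP B (reflection-positivity mirror domination, per torus) and STEP C (square-root domination, per torus)
  rcases n with _ | _ | m
  · -- n = 0 : empty product
    simp [Summit.QuantumFields.YangMills.Cruxes.UVSeamRec.ResponsePinning.torusE_const]
  · -- n = 1 : a centred one-point function vanishes
    have h0 : (0 : ℝ) ≤ (C₂ * (16 * A'' * C) * (((0 + 1 : ℕ) : ℝ)) ^ θ / (R : ℝ) ^ 4) ^ (0 + 1) := by positivity
    simpa [Fin.prod_univ_one, Summit.QuantumFields.YangMills.Theses.SquareRootCeilings.torusE_plane_centred] using h0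
  · set b : ℝ := (16 * A'' * C / (R : ℝ) ^ 4) ^ 2 with hb
    have hb0 : 0 ≤ b := sq_nonneg _
    have hpairs : ∀ (q q' : Fin 4 × Fin 4) (x y : Fin 4 → ℤ), q.1 < q.2 → q'.1 < q'.2 →
        (∃ k : Fin 4, (2 * (R : ℤ) + 4) ≤ |((((x k - y k : ℤ) : ZMod (2 * L + 1))).valMinAbs : ℤ)|) →
        |torusE G r β L (fun U => (plane G r q x U - torusE G r β L (plane G r q x)) *
          (plane G r q' y U - torusE G r β L (plane G r q' y)))| ≤ b := by
      intro q q' x y hq hq' hk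
      obtain ⟨k, hk⟩ := hk
      exact abs_cov_le_of_axisMirror G r hβ0 hR hRL (fun q₁ t hq₁ ht htL => haxis q₁ 0 t hq₁ ht htL)
        hq hq' x y k hk
    have h16 : 0 ≤ 16 * A'' * C := by positivity
    have hsqrt : Real.sqrt b = 16 * A'' * C / (R : ℝ) ^ 4 := by
      rw [hb, Real.sqrt_sq (div_nonneg h16 (pow_nonneg (Nat.cast_nonneg _) _))]
    have key := HD β hβD L R b hR hRL hb0 hpairs (m + 2) q x hq (by omega) hsep
    calc |torusE G r β L (fun U => ∏ i, (plane G r (q i) (x i) U - torusE G r β L (plane G r (q i) (x i))))|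
        ≤ (C₂ * ((m + 2 : ℕ) : ℝ) ^ θ * Real.sqrt b) ^ (m + 2) := key
      _ = (C₂ * (16 * A'' * C) * ((m + 2 : ℕ) : ℝ) ^ θ / (R : ℝ) ^ 4) ^ (m + 2) := by rw [hsqrt]; ring

end Summit.QuantumFields.YangMills.Theorems.TopBandTransferA

end
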